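import Summits.QuantumFields.YangMills.Theorems.FluctuationComparisonRegPrIntLOrganTangentMassOfSmallLiftAnyCut
import Summits.QuantumFields.YangMills.Theorems.FluctuationComparisonRegPrIntLOrganTangentTriangularChart
import Literature.MathematicalPhysics.QuantumFieldTheory.Balaban1983to89.T4TriangularFibredChart
import HarnessLib

/-!
# `FluctuationComparisonRegPrIntLOrganTangentFibredChartData` — (L12a) THE EXPLICIT SPLICED TRIANGULAR CHART OF BAŁABAN'S BLOCK AVERAGE `descend F ℰp j`, AS DATA,
# per height at a generic cut `cW`: ✓TRIc's construction with its BRIDGE′c letters EXPORTED (not consumed)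

Cell `ym3-torus` (rung R3 = continuum `SU(2)` Yang–Mills on T³ — NOT d = 4, NOT infinite volume, NOT a mass gap, NOT Clay), width seat `ym-ust-20520-w5` (gen 22),
pen (L12) (LEAD-20520 w3 g23 WORD №16 (L12) ∕ №17 (iii); ★★OWNER g40 №215), file 1∕2.  `--kind proof --supports stmt-QuantumFields-20520 --as helper`, count-neutral,
definition-free, default heartbeats; THEOREMS ONLY; nothing printed is asserted.

WHY.  The (A)-package road of LINE g25-1 «organ_tangent» is closed at one step (✓(L8) `…APackageFromHeight`, ✓`…VersionClosed`, ✓`…CoareaClosed`), and in each of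
✓TRIc `…TriangularChartAnyCut.regularPackage_of_oneVariableInverseLaws`, ✓(d)c `…APackageAtDescend` and ✓(L11) `…WindowAbsContFromHeight` the explicit fibred chart
`(Φ, J, S)` of `descend F ℰp j` is BUILT INSIDE A PROOF and immediately consumed by a bridge.  LEAD's erratum (STATUS 2026-08-30 20:46Z, census v2.4 §5c): the
m-step package for the composite average `D_m` needed by the v18 O1ᵘ rows does NOT compose at the package level — it must be built at the CHART level (fresh private
coordinates per height, Jacobians multiply, `hmap` by Fubini, (C1′)(C2) per level, (C3) from the iterated small lift).  This file is the one-step brick of that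
composition: the chart AS DATA, with its letters stated as reusable conclusions; file 2∕2 ✓`…OrganTangentFibredChartFromHeight` instantiates it from a height at `24∕25`.

§0 `continuous_extend_uncurry` — `(g, U) ↦ extend β g U` is jointly continuous (coordinate projections) [folklore].
§1 ★★ `fibredChart_of_oneBondLaws_of_lift (cW)` — DETERMINISTIC, generic cut: from the per-bond one-variable inverse-law data `Ω T T′ θ jac M` with the (M1)(M2)(REG)(SOL)(LIFT)
letters of ✓(d)c §1 VERBATIM (no `σ₀` letters, no `hΩS`) and a global measurable section `s` of `descend`: there are `Φ J` (characterised pointwise: on the good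
set `{∀ c, V c ∈ T c U}` `Φ (V, U) = extend β (c ↦ θ c U (V c)) U` and `J (V, U) = ∏_c jac c U (V c)`; off it `Φ (V, U) = s V`, `J (V, U) = 0`) with: `Measurable Φ`,
`Measurable J`; the good set is OPEN and `Φ` is continuous on it; `J (·, U)` is continuous on each good slice; `havgΦ` for EVERY `V` (`descend (Φ (V, U)) = V`); `hmap` for
EVERY measurable base set `A` (`dU_{j+1}⌊(descend⁻¹ A ∩ S) = Φ_*((dU_j⌊A ⊗ dU_{j+1}) · J)`, `S := {U | ∀ c, U (β c) ∈ Ω c U}`); (C1′) `hint` for EVERY environment `U`;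
(C2) `J ≤ M^{#PBond}` pointwise; (C3) the chart mass of the `cW`-window over every window datum (✓MASSc).  Proof = ✓TRIc's body (LEAD w3 g22∕g23) re-cut to export,
with the lit engine ✓`T4TriangularFibredChart.pi_restrict_preimage_inter_eq_map_prod_withDensity_splice` ∕ `apply_triChartSplice_eq` at an arbitrary base set.
NOT HERE: the m-step composition itself; (u)∕(s)∕COAREA∘; anything of Bałaban's estimates.  No `def`, `instance`, `sorry`.
[cite: Balaban1987RG1, (0.4) p.253, (0.13) p.254, (0.18) p.255, (2.4) p.266 and (2.10) p.267; Balaban1985Averaging, (10)-(13) p.19]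

HONEST: a re-cut of landed kernel plumbing + chart calculus + measure theory on the (0.4) block average; (M1)(M2)(LIFT) are HYPOTHESES here (theorems from a height by
✓(L7)(L11)(β′), see file 2∕2); nothing of Bałaban's RG estimates is asserted or proved; O1 ∕ LIN∘ ∕ JVAR∘ ∕ UNIQ-MAX∘ ∕ crux 20520 `FluctuationComparisonRegPrIntL` ∕
`YM3TorusSU2` NOT proved; the registry `Lines/semiclassical_s2beta.lean` v11.4 (★★OWNER RULING №36) untouched; rung R3 = SU(2) YM₃ on T³ — NOT d = 4, NOT infinite volume,
NOT a mass gap, NOT Clay; the Yang–Mills mass gap is NOT proved by any of this.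
-/

set_option autoImplicit false

noncomputable section

namespace Summit.QuantumFields.YangMills.Theorems.FluctuationComparisonRegPrIntLOrganTangentFibredChartData

open MeasureTheory ProbabilityTheory Filter Topology Set Function
open scoped ENNReal NNReal
open Literature.MathematicalPhysics.QuantumFieldTheory.Balaban1983to89
open T3ContinuumYM3Torus T3NestedUnitLaws T3UnitLawDensityEML T3UnitScaleTilt T3LevelShift
open Literature.MathematicalPhysics.QuantumFieldTheory.Balaban1983to89.T3OrbitAverage
open Literature.MathematicalPhysics.QuantumFieldTheory.Balaban1983to89.T4TriangularPushforward (IsLocal)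
open Literature.MathematicalPhysics.QuantumFieldTheory.Balaban1983to89.BlockAveragingHaarAC (centralBond)
open Summit.QuantumFields.YangMills.Theorems.OrganTangentFibreMeanTools
open Summit.QuantumFields.YangMills.Theorems.OrganTangentTriangularChart (isLocal_descend injective_private continuous_extend_left)

/-! ## §0 Joint continuity of the resampling map -/

section Extend

variable {ι κ G : Type*} [TopologicalSpace G] {β : κ → ι}

/-- `(g, U) ↦ extend β g U` is jointly continuous (coordinatewise a projection of one factor or of the other). [folklore] -/
theorem continuous_extend_uncurry (hβ : Injective β) : Continuous fun q : (κ → G) × (ι → G) => extend β q.1 q.2 := by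
  refine continuous_pi fun i => ?_
  by_cases hi : ∃ c, β c = i
  · obtain ⟨c, rfl⟩ := hi
    have : (fun q : (κ → G) × (ι → G) => extend β q.1 q.2 (β c)) = fun q => q.1 c := funext fun q => hβ.extend_apply _ _ _
    rw [this]
    exact (continuous_apply c).comp continuous_fst
  · have : (fun q : (κ → G) × (ι → G) => extend β q.1 q.2 i) = fun q => q.2 i := funext fun q => extend_apply' _ _ _ hi
    rw [this]
    exact (continuous_apply i).comp continuous_snd

end Extend

/-! ## §1 The explicit spliced chart with its letters, per height (generic cut `cW`) -/

/-- ★★ **THE FIBRED CHART OF `descend F ℰp j` AS DATA (generic cut `cW`).**  From the per-bond one-variable inverse-law data in Bałaban's private coordinates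
(`β c := centralBond (bondShift (sitesPerDir_descend F j 0) c)`) with the (M1)(M2)(REG)(SOL)(LIFT) letters of ✓`OrganTangentAPackageAtDescend.regularPackage_of_oneBondLaws_of_lift`
VERBATIM (minus the three `σ₀` letters and `hΩS`, which concern the disintegration ∕ the set `S` alone and are not used to build the chart) and a global measurable
section `s` of `descend F ℰp j`: measurable `Φ`, `J` on `GaugeField_j × GaugeField_{j+1}`, given by the displayed
formulas on∕off the good set `{∀ c, V c ∈ T c U}`, such that the good set is open and carries `Φ` continuously, `J (·, U)` is continuous on every good slice,
`descend (Φ (V, U)) = V` for all `V, U`, the chart identity `hmap` holds over EVERY measurable base set with `S := {U | ∀ c, U (β c) ∈ Ω c U}` and `τ := dU_{j+1}`,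
the (C1′) integrand continuity holds for every environment, `J ≤ M ^ #PBond`, and the `cW`-window has positive chart mass over every window datum.
[cite: Balaban1987RG1, (0.4) p.253, (2.4) p.266 and (2.10) p.267; Balaban1985Averaging, (10)-(13) p.19] -/
theorem fibredChart_of_oneBondLaws_of_lift
    (F : T3Family) (γ b₀ p₀ : ℝ) (j : ℕ) (cW : ℝ)
    (Ω T : PBond (F.P j) 0 → GaugeField (F.P (j + 1)) 0 ↥(Matrix.specialUnitaryGroup (Fin 2) ℂ) → Set ↥(Matrix.specialUnitaryGroup (Fin 2) ℂ))
    (θ : PBond (F.P j) 0 → GaugeField (F.P (j + 1)) 0 ↥(Matrix.specialUnitaryGroup (Fin 2) ℂ) →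
      ↥(Matrix.specialUnitaryGroup (Fin 2) ℂ) → ↥(Matrix.specialUnitaryGroup (Fin 2) ℂ))
    (jac : PBond (F.P j) 0 → GaugeField (F.P (j + 1)) 0 ↥(Matrix.specialUnitaryGroup (Fin 2) ℂ) → ↥(Matrix.specialUnitaryGroup (Fin 2) ℂ) → ℝ≥0)
    (hΩm : ∀ c, MeasurableSet {p : GaugeField (F.P (j + 1)) 0 ↥(Matrix.specialUnitaryGroup (Fin 2) ℂ) × ↥(Matrix.specialUnitaryGroup (Fin 2) ℂ) |
      p.2 ∈ Ω c p.1})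
    (hTm : ∀ c, MeasurableSet {p : GaugeField (F.P (j + 1)) 0 ↥(Matrix.specialUnitaryGroup (Fin 2) ℂ) × ↥(Matrix.specialUnitaryGroup (Fin 2) ℂ) |
      p.2 ∈ T c p.1})
    (hθm : ∀ c, Measurable fun p : GaugeField (F.P (j + 1)) 0 ↥(Matrix.specialUnitaryGroup (Fin 2) ℂ) × ↥(Matrix.specialUnitaryGroup (Fin 2) ℂ) =>
      θ c p.1 p.2)
    (hjm : ∀ c, Measurable fun p : GaugeField (F.P (j + 1)) 0 ↥(Matrix.specialUnitaryGroup (Fin 2) ℂ) × ↥(Matrix.specialUnitaryGroup (Fin 2) ℂ) =>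
      jac c p.1 p.2)
    (hΩbl : ∀ c (U : GaugeField (F.P (j + 1)) 0 ↥(Matrix.specialUnitaryGroup (Fin 2) ℂ)) (g : PBond (F.P j) 0 → ↥(Matrix.specialUnitaryGroup (Fin 2) ℂ)),
      Ω c (extend (fun c : PBond (F.P j) 0 => centralBond (bondShift (sitesPerDir_descend F j 0) c)) g U) = Ω c U)
    (hright : ∀ c U, ∀ v ∈ T c U,
      descend F ℰp j (update U (centralBond (bondShift (sitesPerDir_descend F j 0) c)) (θ c U v)) c = v)
    (hlaw : ∀ c U, (HaarData.haar : Measure ↥(Matrix.specialUnitaryGroup (Fin 2) ℂ)).restrict (Ω c U) =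
      (((HaarData.haar : Measure ↥(Matrix.specialUnitaryGroup (Fin 2) ℂ)).restrict (T c U)).withDensity fun v => (jac c U v : ℝ≥0∞)).map (θ c U))
    (T' : PBond (F.P j) 0 → GaugeField (F.P (j + 1)) 0 ↥(Matrix.specialUnitaryGroup (Fin 2) ℂ) → Set ↥(Matrix.specialUnitaryGroup (Fin 2) ℂ))
    (hT'T : ∀ c U, closure (T' c U) ⊆ T c U)
    (hmargin : ∀ (U : GaugeField (F.P (j + 1)) 0 ↥(Matrix.specialUnitaryGroup (Fin 2) ℂ)) (V : GaugeField (F.P j) 0 ↥(Matrix.specialUnitaryGroup (Fin 2) ℂ)),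
      PlaqSmall (θBal F.L γ b₀ p₀ j) V → (∀ c, V c ∈ T c U) →
      PlaqSmall (cW * θBal F.L γ b₀ p₀ (j + 1))
        (extend (fun c : PBond (F.P j) 0 => centralBond (bondShift (sitesPerDir_descend F j 0) c)) (fun c => θ c U (V c)) U) →
      ∀ c, V c ∈ T' c U)
    (hjc : ∀ c U, ContinuousOn (fun v => (jac c U v : ℝ)) (T c U))
    (M : ℝ≥0) (hjM : ∀ c U v, jac c U v ≤ M)
    (hTo : ∀ c, IsOpen {p : GaugeField (F.P (j + 1)) 0 ↥(Matrix.specialUnitaryGroup (Fin 2) ℂ) × ↥(Matrix.specialUnitaryGroup (Fin 2) ℂ) |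
      p.2 ∈ T c p.1})
    (hθc : ∀ c, ContinuousOn (fun p : GaugeField (F.P (j + 1)) 0 ↥(Matrix.specialUnitaryGroup (Fin 2) ℂ) × ↥(Matrix.specialUnitaryGroup (Fin 2) ℂ) =>
      θ c p.1 p.2) {p | p.2 ∈ T c p.1})
    (hjpos : ∀ c U v, v ∈ T c U → 0 < jac c U v)
    (hsol : ∀ U : GaugeField (F.P (j + 1)) 0 ↥(Matrix.specialUnitaryGroup (Fin 2) ℂ), PlaqSmall (cW * θBal F.L γ b₀ p₀ (j + 1)) U →
      ∀ c, descend F ℰp j U c ∈ T c U ∧ θ c U (descend F ℰp j U c) = U (centralBond (bondShift (sitesPerDir_descend F j 0) c)))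
    (hlift : ∀ V : GaugeField (F.P j) 0 ↥(Matrix.specialUnitaryGroup (Fin 2) ℂ), PlaqSmall (θBal F.L γ b₀ p₀ j) V →
      ∃ U₀ : GaugeField (F.P (j + 1)) 0 ↥(Matrix.specialUnitaryGroup (Fin 2) ℂ),
        descend F ℰp j U₀ = V ∧ PlaqSmall (cW * θBal F.L γ b₀ p₀ (j + 1)) U₀)
    (s : GaugeField (F.P j) 0 ↥(Matrix.specialUnitaryGroup (Fin 2) ℂ) → GaugeField (F.P (j + 1)) 0 ↥(Matrix.specialUnitaryGroup (Fin 2) ℂ))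
    (hsm : Measurable s) (hs : ∀ V, descend F ℰp j (s V) = V) :
    ∃ (Φ : GaugeField (F.P j) 0 ↥(Matrix.specialUnitaryGroup (Fin 2) ℂ) × GaugeField (F.P (j + 1)) 0 ↥(Matrix.specialUnitaryGroup (Fin 2) ℂ) →
          GaugeField (F.P (j + 1)) 0 ↥(Matrix.specialUnitaryGroup (Fin 2) ℂ))
      (J : GaugeField (F.P j) 0 ↥(Matrix.specialUnitaryGroup (Fin 2) ℂ) × GaugeField (F.P (j + 1)) 0 ↥(Matrix.specialUnitaryGroup (Fin 2) ℂ) → ℝ≥0),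
      -- measurability
      Measurable Φ ∧ Measurable J ∧
      -- the formulas on ∕ off the good set
      (∀ V U, (∀ c, V c ∈ T c U) →
        Φ (V, U) = extend (fun c : PBond (F.P j) 0 => centralBond (bondShift (sitesPerDir_descend F j 0) c)) (fun c => θ c U (V c)) U) ∧
      (∀ V U, ¬ (∀ c, V c ∈ T c U) → Φ (V, U) = s V) ∧
      (∀ V U, (∀ c, V c ∈ T c U) → J (V, U) = ∏ c, jac c U (V c)) ∧
      (∀ V U, ¬ (∀ c, V c ∈ T c U) → J (V, U) = 0) ∧
      -- the good set is open and carries the chart continuously; the Jacobian is continuous on every good slice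
      IsOpen {p : GaugeField (F.P j) 0 ↥(Matrix.specialUnitaryGroup (Fin 2) ℂ) × GaugeField (F.P (j + 1)) 0 ↥(Matrix.specialUnitaryGroup (Fin 2) ℂ) |
        ∀ c, p.1 c ∈ T c p.2} ∧
      ContinuousOn Φ {p | ∀ c, p.1 c ∈ T c p.2} ∧
      (∀ U, ContinuousOn (fun V => (J (V, U) : ℝ)) {V | ∀ c, V c ∈ T c U}) ∧
      -- havgΦ (everywhere)
      (∀ V U, descend F ℰp j (Φ (V, U)) = V) ∧
      -- hmap (every measurable base set)
      (∀ A : Set (GaugeField (F.P j) 0 ↥(Matrix.specialUnitaryGroup (Fin 2) ℂ)), MeasurableSet A →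
        (fieldMeasure (F.P (j + 1)) 0 ↥(Matrix.specialUnitaryGroup (Fin 2) ℂ)).restrict
            (descend F ℰp j ⁻¹' A ∩ {U | ∀ c, U (centralBond (bondShift (sitesPerDir_descend F j 0) c)) ∈ Ω c U}) =
          ((((fieldMeasure (F.P j) 0 ↥(Matrix.specialUnitaryGroup (Fin 2) ℂ)).restrict A).prod
              (fieldMeasure (F.P (j + 1)) 0 ↥(Matrix.specialUnitaryGroup (Fin 2) ℂ))).withDensity (fun p => (J p : ℝ≥0∞))).map Φ) ∧
      -- (C1′) integrand continuity on the window, for every environment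
      (∀ f : GaugeField (F.P (j + 1)) 0 ↥(Matrix.specialUnitaryGroup (Fin 2) ℂ) → ℝ, Continuous f →
        (∀ U, f U ≠ 0 → PlaqSmall (cW * θBal F.L γ b₀ p₀ (j + 1)) U) →
        ∀ U : GaugeField (F.P (j + 1)) 0 ↥(Matrix.specialUnitaryGroup (Fin 2) ℂ),
          ContinuousOn (fun V => (J (V, U) : ℝ) * f (Φ (V, U))) {V | PlaqSmall (θBal F.L γ b₀ p₀ j) V}) ∧
      -- (C2) the uniform bound
      (∀ V U, (J (V, U) : ℝ) ≤ (M : ℝ) ^ Fintype.card (PBond (F.P j) 0)) ∧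
      -- (C3) the chart mass of the `cW`-window
      (∀ V, PlaqSmall (θBal F.L γ b₀ p₀ j) V →
        0 < ∫⁻ U in {U | PlaqSmall (cW * θBal F.L γ b₀ p₀ (j + 1)) (Φ (V, U))}, (J (V, U) : ℝ≥0∞)
          ∂(fieldMeasure (F.P (j + 1)) 0 ↥(Matrix.specialUnitaryGroup (Fin 2) ℂ))) := by
  classical
  -- (C3) input: the MASS letter from the small lift (✓MASSc), taken before the abbreviations so that they fold into it
  have hmass := OrganTangentMassOfSmallLiftAnyCut.mass_of_smallLift F γ b₀ p₀ j cW T θ jac hTo hθc hjm hjpos hsol hlift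
  -- names
  set β : PBond (F.P j) 0 → PBond (F.P (j + 1)) 0 := fun c => centralBond (bondShift (sitesPerDir_descend F j 0) c) with hβ
  have hβi : Injective β := injective_private F j
  have hloc : IsLocal β (descend F ℰp j : GaugeField (F.P (j + 1)) 0 ↥(Matrix.specialUnitaryGroup (Fin 2) ℂ) →
      GaugeField (F.P j) 0 ↥(Matrix.specialUnitaryGroup (Fin 2) ℂ)) := isLocal_descend F j
  have hd : Measurable (descend F ℰp j :
      GaugeField (F.P (j + 1)) 0 ↥(Matrix.specialUnitaryGroup (Fin 2) ℂ) →
        GaugeField (F.P j) 0 ↥(Matrix.specialUnitaryGroup (Fin 2) ℂ)) :=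
    T3NestedUnitLaws.measurable_descend F ℰp measurableE_ℰp j
  haveI : IsProbabilityMeasure (HaarData.haar : Measure ↥(Matrix.specialUnitaryGroup (Fin 2) ℂ)) := HaarData.isProb
  haveI : Nonempty ↥(Matrix.specialUnitaryGroup (Fin 2) ℂ) := ⟨1⟩
  haveI : BorelSpace (GaugeField (F.P j) 0 ↥(Matrix.specialUnitaryGroup (Fin 2) ℂ)) := T3OrbitAverage.instBorelSpaceGaugeField
  haveI : BorelSpace (GaugeField (F.P (j + 1)) 0 ↥(Matrix.specialUnitaryGroup (Fin 2) ℂ)) := T3OrbitAverage.instBorelSpaceGaugeField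
  set θj : ℝ := θBal F.L γ b₀ p₀ j with hθj
  set θ' : ℝ := θBal F.L γ b₀ p₀ (j + 1) with hθ'
  set W : Set (GaugeField (F.P j) 0 ↥(Matrix.specialUnitaryGroup (Fin 2) ℂ)) := {V | PlaqSmall θj V} with hW
  -- fibrewise versions of the joint (REG) letters
  have hTo' : ∀ c U, IsOpen (T c U) := fun c U => (hTo c).preimage (Continuous.prodMk_right U)
  have hθc' : ∀ c U, ContinuousOn (θ c U) (T c U) := fun c U =>
    (hθc c).comp (Continuous.prodMk_right U).continuousOn fun v hv => hv
  -- the good set, the chart (spliced) and its Jacobian (terms)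
  set Good : Set (GaugeField (F.P j) 0 ↥(Matrix.specialUnitaryGroup (Fin 2) ℂ) × GaugeField (F.P (j + 1)) 0 ↥(Matrix.specialUnitaryGroup (Fin 2) ℂ)) :=
    {p | ∀ c, p.1 c ∈ T c p.2} with hGood
  let Φ₀ : GaugeField (F.P j) 0 ↥(Matrix.specialUnitaryGroup (Fin 2) ℂ) × GaugeField (F.P (j + 1)) 0 ↥(Matrix.specialUnitaryGroup (Fin 2) ℂ) →
      GaugeField (F.P (j + 1)) 0 ↥(Matrix.specialUnitaryGroup (Fin 2) ℂ) :=
    fun p => extend β (fun c => θ c p.2 (p.1 c)) p.2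
  let Φ : GaugeField (F.P j) 0 ↥(Matrix.specialUnitaryGroup (Fin 2) ℂ) × GaugeField (F.P (j + 1)) 0 ↥(Matrix.specialUnitaryGroup (Fin 2) ℂ) →
      GaugeField (F.P (j + 1)) 0 ↥(Matrix.specialUnitaryGroup (Fin 2) ℂ) :=
    Good.piecewise Φ₀ (fun p => s p.1)
  let J : GaugeField (F.P j) 0 ↥(Matrix.specialUnitaryGroup (Fin 2) ℂ) × GaugeField (F.P (j + 1)) 0 ↥(Matrix.specialUnitaryGroup (Fin 2) ℂ) → ℝ≥0 :=
    fun p => Good.indicator (fun p => ∏ c, jac c p.2 (p.1 c)) p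
  have hGoodm : MeasurableSet Good := T4TriangularFibredChart.measurableSet_forall_mem_fst T hTm
  have hΦ₀m : Measurable Φ₀ := T4TriangularFibredChart.measurable_triChart (β := β) θ hβi hθm
  have hΦm : Measurable Φ :=
    T4TriangularFibredChart.measurable_triChartSplice (β := β) T θ hβi hTm hθm (hsm : Measurable s)
  have hJm : Measurable J := T4TriangularFibredChart.measurable_triJacobian T jac hTm hjm
  -- values of the chart and the Jacobian on / off the good set
  have hΦ_good : ∀ V U, (V, U) ∈ Good → Φ (V, U) = extend β (fun c => θ c U (V c)) U := fun V U h =>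
    Set.piecewise_eq_of_mem _ _ _ h
  have hΦ_bad : ∀ V U, (V, U) ∉ Good → Φ (V, U) = s V := fun V U h => Set.piecewise_eq_of_notMem _ _ _ h
  have hJ_good : ∀ V U, (V, U) ∈ Good → J (V, U) = ∏ c, jac c U (V c) := fun V U h => indicator_of_mem h _
  have hJ_bad : ∀ V U, (V, U) ∉ Good → J (V, U) = 0 := fun V U h => indicator_of_notMem h _
  -- the good set is open (jointly), the chart is continuous on it, the Jacobian on every good slice
  have hGoodOpen : IsOpen Good := by
    have e : Good = ⋂ c, (fun p : GaugeField (F.P j) 0 ↥(Matrix.specialUnitaryGroup (Fin 2) ℂ) ×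
        GaugeField (F.P (j + 1)) 0 ↥(Matrix.specialUnitaryGroup (Fin 2) ℂ) => (p.2, p.1 c)) ⁻¹'
          {q : GaugeField (F.P (j + 1)) 0 ↥(Matrix.specialUnitaryGroup (Fin 2) ℂ) × ↥(Matrix.specialUnitaryGroup (Fin 2) ℂ) | q.2 ∈ T c q.1} := by
      ext p; simp only [hGood, Set.mem_setOf_eq, Set.mem_iInter, Set.mem_preimage]
    rw [e]
    exact isOpen_iInter_of_finite fun c => (hTo c).preimage (continuous_snd.prodMk ((continuous_apply c).comp continuous_fst))
  have hΦcont : ContinuousOn Φ Good := by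
    have h0 : ContinuousOn Φ₀ Good := by
      have h1c : ∀ c, ContinuousOn (fun p : GaugeField (F.P j) 0 ↥(Matrix.specialUnitaryGroup (Fin 2) ℂ) ×
          GaugeField (F.P (j + 1)) 0 ↥(Matrix.specialUnitaryGroup (Fin 2) ℂ) => θ c p.2 (p.1 c)) Good := fun c => by
        have hf : Continuous fun p : GaugeField (F.P j) 0 ↥(Matrix.specialUnitaryGroup (Fin 2) ℂ) ×
            GaugeField (F.P (j + 1)) 0 ↥(Matrix.specialUnitaryGroup (Fin 2) ℂ) => (p.2, p.1 c) :=
          continuous_snd.prodMk ((continuous_apply c).comp continuous_fst)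
        exact (hθc c).comp hf.continuousOn fun p (hp : p ∈ Good) => show p.1 c ∈ T c p.2 from hp c
      have h1 : ContinuousOn (fun p : GaugeField (F.P j) 0 ↥(Matrix.specialUnitaryGroup (Fin 2) ℂ) ×
          GaugeField (F.P (j + 1)) 0 ↥(Matrix.specialUnitaryGroup (Fin 2) ℂ) => fun c => θ c p.2 (p.1 c)) Good :=
        continuousOn_pi.2 h1c
      exact (continuous_extend_uncurry (G := ↥(Matrix.specialUnitaryGroup (Fin 2) ℂ)) hβi).comp_continuousOn (h1.prodMk continuousOn_snd)
    exact h0.congr fun p hp => Set.piecewise_eq_of_mem _ _ _ hp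
  have hJslice : ∀ U, ContinuousOn (fun V : GaugeField (F.P j) 0 ↥(Matrix.specialUnitaryGroup (Fin 2) ℂ) => (J (V, U) : ℝ))
      {V | ∀ c, V c ∈ T c U} := by
    intro U
    have h1 : ContinuousOn (fun V : GaugeField (F.P j) 0 ↥(Matrix.specialUnitaryGroup (Fin 2) ℂ) => ∏ c, (jac c U (V c) : ℝ))
        {V | ∀ c, V c ∈ T c U} :=
      continuousOn_finsetProd _ fun c _ => (hjc c U).comp (continuous_apply c).continuousOn fun V hV => hV c
    refine h1.congr fun V hV => ?_
    have hmem : (V, U) ∈ Good := hV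
    simp only [hJ_good V U hmem, NNReal.coe_prod]
  -- the fibred chart identity of the T⁴ engine at `descend` (spliced), over any measurable base set
  have hmap : ∀ A : Set (GaugeField (F.P j) 0 ↥(Matrix.specialUnitaryGroup (Fin 2) ℂ)), MeasurableSet A →
      (fieldMeasure (F.P (j + 1)) 0 ↥(Matrix.specialUnitaryGroup (Fin 2) ℂ)).restrict (descend F ℰp j ⁻¹' A ∩ {U | ∀ c, U (β c) ∈ Ω c U}) =
        ((((fieldMeasure (F.P j) 0 ↥(Matrix.specialUnitaryGroup (Fin 2) ℂ)).restrict A).prod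
            (fieldMeasure (F.P (j + 1)) 0 ↥(Matrix.specialUnitaryGroup (Fin 2) ℂ))).withDensity (fun p => (J p : ℝ≥0∞))).map Φ :=
    fun A hA => T4TriangularFibredChart.pi_restrict_preimage_inter_eq_map_prod_withDensity_splice (β := β) (A := descend F ℰp j) Ω T θ jac
      (HaarData.haar : Measure ↥(Matrix.specialUnitaryGroup (Fin 2) ℂ)) (HaarData.haar : Measure ↥(Matrix.specialUnitaryGroup (Fin 2) ℂ))
      hloc hβi hd hΩm hTm hθm hjm hΩbl hright hlaw s hA
  -- the spliced chart lies over the coarse variable (everywhere: the section is global)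
  have havgΦ : ∀ V U, descend F ℰp j (Φ (V, U)) = V := fun V U =>
    T4TriangularFibredChart.apply_triChartSplice_eq (β := β) (A := descend F ℰp j) T θ hloc hβi hright (σ := s) (U₀ := univ)
      (fun V _ => hs V) V (mem_univ V) U
  -- (C1′): continuity of the integrands on the window, for every environment
  have hint : ∀ f : GaugeField (F.P (j + 1)) 0 ↥(Matrix.specialUnitaryGroup (Fin 2) ℂ) → ℝ, Continuous f →
      (∀ U, f U ≠ 0 → PlaqSmall (cW * θ') U) →
      ∀ U : GaugeField (F.P (j + 1)) 0 ↥(Matrix.specialUnitaryGroup (Fin 2) ℂ), ContinuousOn (fun V => (J (V, U) : ℝ) * f (Φ (V, U))) W := by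
    intro f hf hsupp U
    -- the good slice and its inner companion
    set G : Set (GaugeField (F.P j) 0 ↥(Matrix.specialUnitaryGroup (Fin 2) ℂ)) := {V | ∀ c, V c ∈ T c U} with hG
    set G' : Set (GaugeField (F.P j) 0 ↥(Matrix.specialUnitaryGroup (Fin 2) ℂ)) := {V | ∀ c, V c ∈ T' c U} with hG'
    have hGopen : IsOpen G := by
      have e : G = ⋂ c, (fun V : GaugeField (F.P j) 0 ↥(Matrix.specialUnitaryGroup (Fin 2) ℂ) => V c) ⁻¹' T c U := by
        ext V; simp only [hG, Set.mem_setOf_eq, Set.mem_iInter, Set.mem_preimage]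
      rw [e]
      exact isOpen_iInter_of_finite fun c => (hTo' c U).preimage (continuous_apply c)
    have hclG' : closure G' ⊆ G := by
      intro V hV c
      have h1 : V c ∈ closure (T' c U) := by
        have hcont : Continuous fun V' : GaugeField (F.P j) 0 ↥(Matrix.specialUnitaryGroup (Fin 2) ℂ) => V' c := continuous_apply c
        exact map_mem_closure (f := fun V' : GaugeField (F.P j) 0 ↥(Matrix.specialUnitaryGroup (Fin 2) ℂ) => V' c) (x := V)
          hcont hV fun V' hV' => hV' c
      exact hT'T c U h1
    -- the smooth branch on `G`
    have hbranch : ContinuousOn (fun V : GaugeField (F.P j) 0 ↥(Matrix.specialUnitaryGroup (Fin 2) ℂ) =>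
        (∏ c, (jac c U (V c) : ℝ)) * f (extend β (fun c => θ c U (V c)) U)) G := by
      have h1 : ContinuousOn (fun V : GaugeField (F.P j) 0 ↥(Matrix.specialUnitaryGroup (Fin 2) ℂ) => ∏ c, (jac c U (V c) : ℝ)) G :=
        continuousOn_finsetProd _ fun c _ => (hjc c U).comp (continuous_apply c).continuousOn fun V hV => hV c
      have h2 : ContinuousOn (fun V : GaugeField (F.P j) 0 ↥(Matrix.specialUnitaryGroup (Fin 2) ℂ) => fun c => θ c U (V c)) G :=
        continuousOn_pi.2 fun c => (hθc' c U).comp (continuous_apply c).continuousOn fun V hV => hV c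
      exact h1.mul (hf.comp_continuousOn ((continuous_extend_left hβi U).comp_continuousOn h2))
    -- pointwise: inside `G` the integrand is the branch, outside `closure G'` it vanishes near the point
    intro V₀ hV₀
    by_cases hVG : V₀ ∈ G
    · have heq : (fun V => (J (V, U) : ℝ) * f (Φ (V, U))) =ᶠ[nhdsWithin V₀ W]
          fun V => (∏ c, (jac c U (V c) : ℝ)) * f (extend β (fun c => θ c U (V c)) U) := by
        filter_upwards [mem_nhdsWithin_of_mem_nhds (hGopen.mem_nhds hVG)] with V hV
        have hmem : (V, U) ∈ Good := hV
        simp only [hJ_good V U hmem, hΦ_good V U hmem, NNReal.coe_prod]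
      refine (ContinuousWithinAt.congr_of_eventuallyEq ?_ heq ?_)
      · exact ((hbranch V₀ hVG).continuousAt (hGopen.mem_nhds hVG)).continuousWithinAt
      · have hmem : (V₀, U) ∈ Good := hVG
        simp only [hJ_good V₀ U hmem, hΦ_good V₀ U hmem, NNReal.coe_prod]
    · -- off `G`: a neighbourhood within the window where the integrand vanishes
      have hV₀cl : V₀ ∉ closure G' := fun h => hVG (hclG' h)
      have hN : (closure G')ᶜ ∈ nhds V₀ := isClosed_closure.isOpen_compl.mem_nhds hV₀cl
      have hzero : ∀ V, V ∈ W → V ∉ closure G' → (J (V, U) : ℝ) * f (Φ (V, U)) = 0 := by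
        intro V hVW hVcl
        by_cases hVg : (V, U) ∈ Good
        · -- good but not inner-good: the chart point is not cW-small, so `f` vanishes
          have hnot : ¬ PlaqSmall (cW * θ') (extend β (fun c => θ c U (V c)) U) := by
            intro hsmall
            exact hVcl (subset_closure (hmargin U V hVW hVg hsmall))
          have hf0 : f (Φ (V, U)) = 0 := by
            rw [hΦ_good V U hVg]
            by_contra h
            exact hnot (hsupp _ h)
          rw [hf0, mul_zero]
        · rw [hJ_bad V U hVg, NNReal.coe_zero, zero_mul]
      have heq : (fun V => (J (V, U) : ℝ) * f (Φ (V, U))) =ᶠ[nhdsWithin V₀ W] fun _ => (0 : ℝ) := by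
        filter_upwards [mem_nhdsWithin_of_mem_nhds hN, self_mem_nhdsWithin] with V hV hVW
        exact hzero V hVW hV
      exact (continuousWithinAt_const.congr_of_eventuallyEq heq (hzero V₀ hV₀ hV₀cl))
  -- (C2): a constant bound on the Jacobian (everywhere)
  have hJB : ∀ V U, (J (V, U) : ℝ) ≤ ((M : ℝ) ^ Fintype.card (PBond (F.P j) 0)) := by
    intro V U
    have h1 : J (V, U) ≤ ∏ c : PBond (F.P j) 0, jac c U (V c) := by
      show Good.indicator (fun p => ∏ c, jac c p.2 (p.1 c)) (V, U) ≤ _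
      exact indicator_le_self _ _ _
    have h2 : ∏ c : PBond (F.P j) 0, jac c U (V c) ≤ ∏ _c : PBond (F.P j) 0, M :=
      Finset.prod_le_prod' fun c _ => hjM c U (V c)
    rw [Finset.prod_const, Finset.card_univ] at h2
    exact_mod_cast h1.trans h2
  -- (C3): the mass letter (✓MASSc) in the bridge's form
  have hmass' : ∀ V, PlaqSmall θj V →
      0 < ∫⁻ U in {U | PlaqSmall (cW * θ') (Φ (V, U))}, (J (V, U) : ℝ≥0∞)
        ∂(fieldMeasure (F.P (j + 1)) 0 ↥(Matrix.specialUnitaryGroup (Fin 2) ℂ)) := by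
    intro V hV
    refine (hmass V hV).trans_le ?_
    have hA : MeasurableSet {U : GaugeField (F.P (j + 1)) 0 ↥(Matrix.specialUnitaryGroup (Fin 2) ℂ) | (∀ c, V c ∈ T c U) ∧
        PlaqSmall (cW * θ') (extend β (fun c => θ c U (V c)) U)} := by
      have hO₃m : MeasurableSet {U : GaugeField (F.P (j + 1)) 0 ↥(Matrix.specialUnitaryGroup (Fin 2) ℂ) | PlaqSmall (cW * θ') U} := by
        have e : {U : GaugeField (F.P (j + 1)) 0 ↥(Matrix.specialUnitaryGroup (Fin 2) ℂ) | PlaqSmall (cW * θ') U} =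
            ⋂ p : Plaq (F.P (j + 1)) 0, {U | dist1 (GaugeField.plaqHol U p) < cW * θ'} := by
          ext U; simp only [PlaqSmall, Set.mem_setOf_eq, Set.mem_iInter]
        rw [e]
        exact (isOpen_iInter_of_finite fun p => isOpen_lt (continuous_dist1_plaqHol p) continuous_const).measurableSet
      have hΦ₀Vm : Measurable fun U => Φ₀ (V, U) := hΦ₀m.comp measurable_prodMk_left
      have e : {U : GaugeField (F.P (j + 1)) 0 ↥(Matrix.specialUnitaryGroup (Fin 2) ℂ) | (∀ c, V c ∈ T c U) ∧
          PlaqSmall (cW * θ') (extend β (fun c => θ c U (V c)) U)} =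
          {U | (V, U) ∈ Good} ∩ (fun U => Φ₀ (V, U)) ⁻¹' {U | PlaqSmall (cW * θ') U} := by
        ext U; rfl
      rw [e]
      exact (show MeasurableSet {U : GaugeField (F.P (j + 1)) 0 ↥(Matrix.specialUnitaryGroup (Fin 2) ℂ) | (V, U) ∈ Good} from
        measurable_prodMk_left hGoodm).inter (hΦ₀Vm hO₃m)
    -- on the good cW-small set the Jacobian IS the product and the spliced chart IS the chart: a sub-integral of the bridge's mass
    have key : ∀ A : Set (GaugeField (F.P (j + 1)) 0 ↥(Matrix.specialUnitaryGroup (Fin 2) ℂ)), MeasurableSet A →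
        (∀ U ∈ A, (V, U) ∈ Good ∧ PlaqSmall (cW * θ') (extend β (fun c => θ c U (V c)) U)) →
        ∫⁻ U in A, (∏ c, (jac c U (V c) : ℝ≥0∞)) ∂(fieldMeasure (F.P (j + 1)) 0 ↥(Matrix.specialUnitaryGroup (Fin 2) ℂ)) ≤
          ∫⁻ U in {U | PlaqSmall (cW * θ') (Φ (V, U))}, (J (V, U) : ℝ≥0∞)
            ∂(fieldMeasure (F.P (j + 1)) 0 ↥(Matrix.specialUnitaryGroup (Fin 2) ℂ)) := by
      intro A hAm hAin
      have h1 : ∫⁻ U in A, (∏ c, (jac c U (V c) : ℝ≥0∞)) ∂(fieldMeasure (F.P (j + 1)) 0 ↥(Matrix.specialUnitaryGroup (Fin 2) ℂ)) =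
          ∫⁻ U in A, (J (V, U) : ℝ≥0∞) ∂(fieldMeasure (F.P (j + 1)) 0 ↥(Matrix.specialUnitaryGroup (Fin 2) ℂ)) := by
        refine lintegral_congr_ae ((ae_restrict_iff' hAm).2 (Eventually.of_forall fun U hU => ?_))
        show (∏ c, (jac c U (V c) : ℝ≥0∞)) = ((J (V, U) : ℝ≥0) : ℝ≥0∞)
        rw [hJ_good V U (hAin U hU).1, ENNReal.ofNNReal_finsetProd]
      rw [h1]
      refine lintegral_mono_set fun U hU => ?_
      show PlaqSmall (cW * θ') (Φ (V, U))
      rw [hΦ_good V U (hAin U hU).1]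
      exact (hAin U hU).2
    exact key _ hA fun U hU => hU
  -- assemble
  refine ⟨Φ, J, hΦm, hJm, fun V U h => hΦ_good V U h, fun V U h => hΦ_bad V U h, fun V U h => hJ_good V U h,
    fun V U h => hJ_bad V U h, hGoodOpen, hΦcont, hJslice, havgΦ, hmap, hint, hJB, hmass'⟩

end Summit.QuantumFields.YangMills.Theorems.FluctuationComparisonRegPrIntLOrganTangentFibredChartData

end
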